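import Summits.CriticalPhenomena.PercolationContinuityZ3.Theorems.PercNearOneGluingNoHeavyLowerTailStarSetComonotone
import Summits.CriticalPhenomena.PercolationContinuityZ3.Theorems.PercNearOneGluingNoHeavyLowerTailStarSetGateExpansion
import Summits.CriticalPhenomena.PercolationContinuityZ3.Theorems.PercNearOneGluingNoHeavyLowerTailStarSetRegroup
import HarnessLib

/-!
# `NoHeavyLowerTail` (stmt-CriticalPhenomena-4575) — OES at level `j ≤ 2` for ANY NUMBER of two-port pendant stars with distinct ports

Support file (prover `prim-gen-swap` gen 7; `--supports stmt-CriticalPhenomena-4575`).  No definitions, no named facts, no sorries.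

**Theorem (`StarSet.setCS_twoPortStars_levelTwo`).**  `μ = prodBernoulli w` on `Fin n`, relays `A`, level `j ≤ 2`; `m` star centres
`s i ∉ A` (pairwise distinct), star `i` having positive pairs only to its two ports `p i ≠ p' i ∈ A`, the `2m` ports pairwise distinct;
`c ∈ A` not a port with `μ{|π(p)| ≤ j} ≤ μ{|π(c)| ≤ j}` for every port `p`.  Then, with `S = {s i}`,
`CS_w(S, c)`:  `μ(c ↮ S, 1 ≤ |π(S)| ≤ j) ≤ μ(c ↮ S, |π(c)| ≤ j)`.
(`m = 2` is `TwoPortPeeling.championStabilityPair_twoStars_levelTwo` / `setCS_pair_twoPort_levelTwo`; `m ≥ 3` is new.  With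
prim-gen-induct's `cil_of_starStability` it yields CIL_j, `j ≤ 2`, every `|A|`, at observers whose Steiner neighbours are such stars.)

Proof (seat memo R3-SEATS.md §7; every step is a landed brick):
(1) `StarSet.setCSdiff_gate_expansion`: `CSdiff = Σ_t ι(t)·f(Y(t))` over the joint states `t` of the stars, honest cells of the port sets;
(2)–(3) `StarSet.extreme_regroup`: `= Σ_e (Π_i a_i(e_i))·Σ_σ w(σ) f(Y(t(e,σ)))` over the extreme words `e ∈ {C, G, G'}^m`, `a ≥ 0`;
glued words (`StarSet.gluedWord_nonneg`): the cells dominate the link-glued cells of the designated port set `R_e` pointwise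
(`StarSet.sepSmall_links_iff`, `StarSet.sepLonely_links_of`) and the latter sum to `CS_{w_G}(R_e, c) ≥ 0` (`StarSet.linkRow_le`, BHK);
the comonotone word (`StarSet.comonotone_word_nonneg`): the nested certificate.  Hence `CSdiff ≥ 0`.
-/

noncomputable section

namespace Summit.CriticalPhenomena.PercolationContinuityZ3.Theorems

open MeasureTheory Set Literature.Probability.LatticeModels Literature.Probability.Percolation
open scoped Classical BigOperators

variable {n m : ℕ}

namespace StarSet

/-- Cardinalities of filters by equivalent predicates agree (any decidability instances). [folklore] -/
theorem card_filter_congr {α : Type*} {A : Finset α} {P Q : α → Prop} {instP : DecidablePred P}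
    {instQ : DecidablePred Q} (hPQ : ∀ z ∈ A, (P z ↔ Q z)) :
    (@Finset.filter α P instP A).card = (@Finset.filter α Q instQ A).card := by
  rw [@Finset.filter_congr α P Q instP instQ A hPQ]

/-- **A glued word is nonnegative.**  For a word `e` with a glued star `i₀` (`e i₀ ≠ 0`), designated port set
`R_e = {p i : e i = 1} ∪ {p' i : e i = 2}` and cell port sets `Y(σ) = R_e ∪ P_σ`:
`0 ≤ Σ_σ w(σ)·[μ(c ↮_ξ Y(σ), |π_ξ(c)| ≤ j) − μ(c ↮_ξ Y(σ), 1 ≤ |π_ξ(Y(σ))| ≤ j)]` (`j ≤ 2`, `c` dominating the ports).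
[cite: VandenbergHaggstromKahn2005, Thm. 1.5 (p. 7) — via `StarSet.linkRow_le`] -/
theorem gluedWord_nonneg (w : Sym2 (Fin n) → unitInterval) (A : Finset (Fin n)) (s p p' : Fin m → Fin n) (c : Fin n)
    (j : ℕ) (hj : j ≤ 2) (hs : Function.Injective s) (hsA : ∀ i, s i ∉ A) (hpA : ∀ i, p i ∈ A) (hp'A : ∀ i, p' i ∈ A)
    (hpp' : ∀ i, p i ≠ p' i) (hcA : c ∈ A) (hcp : ∀ i, c ≠ p i ∧ c ≠ p' i)
    (hwjunk : ∀ i u, u ≠ s i → u ≠ p i → u ≠ p' i → w s(s i, u) = 0)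
    (hdom : ∀ i,
      (prodBernoulli w).real {ω : BondConfig (Fin n) | (A.filter fun z => ω ∈ openConn (p i) z).card ≤ j} ≤
          (prodBernoulli w).real {ω : BondConfig (Fin n) | (A.filter fun z => ω ∈ openConn c z).card ≤ j} ∧
        (prodBernoulli w).real {ω : BondConfig (Fin n) | (A.filter fun z => ω ∈ openConn (p' i) z).card ≤ j} ≤
          (prodBernoulli w).real {ω : BondConfig (Fin n) | (A.filter fun z => ω ∈ openConn c z).card ≤ j})
    (e : Fin m → Fin 3) (i₀ : Fin m) (he : e i₀ ≠ 0) (Y : Finset (Fin m) → Finset (Fin n))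
    (hY : ∀ σ u, u ∈ Y σ ↔
      u ∈ (Finset.univ.filter fun i => e i = 1).image p ∪ (Finset.univ.filter fun i => e i = 2).image p' ∨
        u ∈ σ.image p ∪ σ.image p') :
    0 ≤ ∑ σ ∈ (Finset.univ : Finset (Fin m)).powerset,
      ((∏ i ∈ σ, ((w s(s i, p i) : ℝ) * w s(s i, p' i))) *
          ∏ i ∈ Finset.univ \ σ, (1 - (w s(s i, p i) : ℝ) * w s(s i, p' i))) *
        ((prodBernoulli w).real {ω : BondConfig (Fin n) |
            (∀ u ∈ Y σ, ¬ (openGraph (ω ∩ {e | ∀ v ∈ Finset.univ.image s, v ∉ e})).Reachable c u) ∧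
            (A.filter fun z => (openGraph (ω ∩ {e | ∀ v ∈ Finset.univ.image s, v ∉ e})).Reachable c z).card ≤ j} -
          (prodBernoulli w).real {ω : BondConfig (Fin n) |
            (∀ u ∈ Y σ, ¬ (openGraph (ω ∩ {e | ∀ v ∈ Finset.univ.image s, v ∉ e})).Reachable c u) ∧
            1 ≤ (A.filter fun z => ∃ u ∈ Y σ, (openGraph (ω ∩ {e | ∀ v ∈ Finset.univ.image s, v ∉ e})).Reachable u z).card ∧
            (A.filter fun z => ∃ u ∈ Y σ,
              (openGraph (ω ∩ {e | ∀ v ∈ Finset.univ.image s, v ∉ e})).Reachable u z).card ≤ j}) := by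
  have hps : ∀ i k, p i ≠ s k := fun i k h => hsA k (h ▸ hpA i)
  have hp's : ∀ i k, p' i ≠ s k := fun i k h => hsA k (h ▸ hp'A i)
  have hcs : ∀ i, c ≠ s i := fun i h => hsA i (h ▸ hcA)
  set θ : Fin m → ℝ := fun i => (w s(s i, p i) : ℝ) * w s(s i, p' i) with hθ
  have hθ0 : ∀ i, 0 ≤ θ i := fun i => mul_nonneg (w _).2.1 (w _).2.1
  have hθ1 : ∀ i, θ i ≤ 1 := fun i => mul_le_one₀ (w _).2.2 (w _).2.1 (w _).2.2
  set ξ : BondConfig (Fin n) → BondConfig (Fin n) := fun ω => ω ∩ {e | ∀ v ∈ Finset.univ.image s, v ∉ e} with hξ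
  set R : Finset (Fin n) := (Finset.univ.filter fun i => e i = 1).image p ∪ (Finset.univ.filter fun i => e i = 2).image p'
    with hR
  have hRport : ∀ u ∈ R, ∃ i, u = p i ∨ u = p' i := by
    intro u hu
    rw [hR, Finset.mem_union, Finset.mem_image, Finset.mem_image] at hu
    rcases hu with ⟨i, -, rfl⟩ | ⟨i, -, rfl⟩
    · exact ⟨i, Or.inl rfl⟩
    · exact ⟨i, Or.inr rfl⟩
  have hRs : ∀ u ∈ R, ∀ i, u ≠ s i := by
    intro u hu k
    obtain ⟨i, rfl | rfl⟩ := hRport u hu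
    · exact hps i k
    · exact hp's i k
  have hRA : ∀ u ∈ R, u ∈ A := by
    intro u hu
    obtain ⟨i, rfl | rfl⟩ := hRport u hu
    · exact hpA i
    · exact hp'A i
  -- the designated port of the glued star `i₀`
  obtain ⟨y, hyR, hyle⟩ : ∃ y ∈ R,
      (prodBernoulli w).real {ω : BondConfig (Fin n) | (A.filter fun z => ω ∈ openConn y z).card ≤ j} ≤
        (prodBernoulli w).real {ω : BondConfig (Fin n) | (A.filter fun z => ω ∈ openConn c z).card ≤ j} := by
    by_cases h1 : e i₀ = 1
    · refine ⟨p i₀, ?_, (hdom i₀).1⟩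
      rw [hR]
      exact Finset.mem_union_left _ (Finset.mem_image_of_mem p (Finset.mem_filter.2 ⟨Finset.mem_univ _, h1⟩))
    · have h2 : e i₀ = 2 := by
        have hlt := (e i₀).isLt
        have h0 : (e i₀).val ≠ 0 := fun h => he (Fin.ext h)
        have h1' : (e i₀).val ≠ 1 := fun h => h1 (Fin.ext h)
        exact Fin.ext (by show (e i₀).val = 2; omega)
      refine ⟨p' i₀, ?_, (hdom i₀).2⟩
      rw [hR]
      exact Finset.mem_union_right _ (Finset.mem_image_of_mem p' (Finset.mem_filter.2 ⟨Finset.mem_univ _, h2⟩))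
  have hyA : y ∈ A := hRA y hyR
  have hrow := linkRow_le w A s p p' R y c j hs hps hp's hpp' hwjunk hsA hRs hcs hyR hyle
  -- the links of a pattern
  have hΛ : ∀ σ : Finset (Fin m), ∀ l ∈ σ.image (fun i => (s(p i, p' i) : Sym2 (Fin n))),
      ∃ q q', l = s(q, q') ∧ q ≠ q' ∧ q ∈ A ∧ q' ∈ A ∧ q ≠ c ∧ q' ≠ c := by
    intro σ l hl
    obtain ⟨i, -, rfl⟩ := Finset.mem_image.1 hl
    exact ⟨p i, p' i, rfl, hpp' i, hpA i, hp'A i, (hcp i).1.symm, (hcp i).2.symm⟩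
  -- membership in `Y σ` = membership in `R` or in a link
  have hYmem : ∀ σ u, u ∈ Y σ ↔ u ∈ R ∨ ∃ l ∈ σ.image (fun i => (s(p i, p' i) : Sym2 (Fin n))), u ∈ l := by
    intro σ u
    rw [hY σ u, ← mem_portPattern_iff p p' σ u]
  -- termwise comparison with the link-glued cells of `R`
  have hterm : ∀ σ : Finset (Fin m),
      (prodBernoulli w).real {ω : BondConfig (Fin n) |
          (∀ u ∈ R, ¬ (openGraph (ξ ω ∪ ↑(σ.image fun i => (s(p i, p' i) : Sym2 (Fin n))))).Reachable c u) ∧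
          (A.filter fun z => (openGraph (ξ ω ∪ ↑(σ.image fun i => (s(p i, p' i) : Sym2 (Fin n))))).Reachable c z).card ≤ j} -
        (prodBernoulli w).real {ω : BondConfig (Fin n) |
          (∀ u ∈ R, ¬ (openGraph (ξ ω ∪ ↑(σ.image fun i => (s(p i, p' i) : Sym2 (Fin n))))).Reachable c u) ∧
          1 ≤ (A.filter fun z => ∃ u ∈ R,
            (openGraph (ξ ω ∪ ↑(σ.image fun i => (s(p i, p' i) : Sym2 (Fin n))))).Reachable u z).card ∧
          (A.filter fun z => ∃ u ∈ R,
            (openGraph (ξ ω ∪ ↑(σ.image fun i => (s(p i, p' i) : Sym2 (Fin n))))).Reachable u z).card ≤ j} ≤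
      (prodBernoulli w).real {ω : BondConfig (Fin n) |
          (∀ u ∈ Y σ, ¬ (openGraph (ξ ω)).Reachable c u) ∧ (A.filter fun z => (openGraph (ξ ω)).Reachable c z).card ≤ j} -
        (prodBernoulli w).real {ω : BondConfig (Fin n) |
          (∀ u ∈ Y σ, ¬ (openGraph (ξ ω)).Reachable c u) ∧
          1 ≤ (A.filter fun z => ∃ u ∈ Y σ, (openGraph (ξ ω)).Reachable u z).card ∧
          (A.filter fun z => ∃ u ∈ Y σ, (openGraph (ξ ω)).Reachable u z).card ≤ j} := by
    intro σ
    -- ρ-cells are equal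
    have hρ : (prodBernoulli w).real {ω : BondConfig (Fin n) |
          (∀ u ∈ Y σ, ¬ (openGraph (ξ ω)).Reachable c u) ∧ (A.filter fun z => (openGraph (ξ ω)).Reachable c z).card ≤ j} =
        (prodBernoulli w).real {ω : BondConfig (Fin n) |
          (∀ u ∈ R, ¬ (openGraph (ξ ω ∪ ↑(σ.image fun i => (s(p i, p' i) : Sym2 (Fin n))))).Reachable c u) ∧
          (A.filter fun z => (openGraph (ξ ω ∪ ↑(σ.image fun i => (s(p i, p' i) : Sym2 (Fin n))))).Reachable c z).card ≤ j} := by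
      congr 1
      ext ω
      simp only [mem_setOf_eq]
      have key := sepSmall_links_iff (ξ ω) (σ.image fun i => (s(p i, p' i) : Sym2 (Fin n))) A R c j hj hcA (hΛ σ)
      constructor
      · rintro ⟨hsep, hsmall⟩
        have h3 := key.1 ⟨fun u hu => hsep u ((hYmem σ u).2 (Or.inl hu)),
          fun l hl v hv => hsep v ((hYmem σ v).2 (Or.inr ⟨l, hl, hv⟩)), (card_filter_congr fun z _ => Iff.rfl).le.trans hsmall⟩
        exact ⟨h3.1, (card_filter_congr fun z _ => Iff.rfl).le.trans h3.2⟩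
      · rintro ⟨hsep, hsmall⟩
        have h3 := key.2 ⟨hsep, (card_filter_congr fun z _ => Iff.rfl).le.trans hsmall⟩
        refine ⟨fun u hu => ?_, (card_filter_congr fun z _ => Iff.rfl).le.trans h3.2.2⟩
        rcases (hYmem σ u).1 hu with hu | ⟨l, hl, hul⟩
        · exact h3.1 u hu
        · exact h3.2.1 l hl u hul
    -- ℓ-cells only grow
    have hℓ : (prodBernoulli w).real {ω : BondConfig (Fin n) |
          (∀ u ∈ Y σ, ¬ (openGraph (ξ ω)).Reachable c u) ∧
          1 ≤ (A.filter fun z => ∃ u ∈ Y σ, (openGraph (ξ ω)).Reachable u z).card ∧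
          (A.filter fun z => ∃ u ∈ Y σ, (openGraph (ξ ω)).Reachable u z).card ≤ j} ≤
        (prodBernoulli w).real {ω : BondConfig (Fin n) |
          (∀ u ∈ R, ¬ (openGraph (ξ ω ∪ ↑(σ.image fun i => (s(p i, p' i) : Sym2 (Fin n))))).Reachable c u) ∧
          1 ≤ (A.filter fun z => ∃ u ∈ R,
            (openGraph (ξ ω ∪ ↑(σ.image fun i => (s(p i, p' i) : Sym2 (Fin n))))).Reachable u z).card ∧
          (A.filter fun z => ∃ u ∈ R,
            (openGraph (ξ ω ∪ ↑(σ.image fun i => (s(p i, p' i) : Sym2 (Fin n))))).Reachable u z).card ≤ j} := by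
      refine measureReal_mono (fun ω hω => ?_)
      simp only [mem_setOf_eq] at hω ⊢
      obtain ⟨hsep, -, h2⟩ := hω
      have h3 := sepLonely_links_of (ξ ω) (σ.image fun i => (s(p i, p' i) : Sym2 (Fin n))) A R c j ⟨y, hyR, hyA⟩
        ⟨fun u hu => hsep u ((hYmem σ u).2 (Or.inl hu)), fun l hl v hv => hsep v ((hYmem σ v).2 (Or.inr ⟨l, hl, hv⟩)),
          (card_filter_congr fun z _ => ?_).le.trans h2⟩
      · exact ⟨h3.1, h3.2.1.trans (card_filter_congr fun z _ => Iff.rfl).le,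
          (card_filter_congr fun z _ => Iff.rfl).le.trans h3.2.2⟩
      · constructor
        · rintro ⟨u, hu, huz⟩
          exact ⟨u, (hYmem σ u).2 hu, huz⟩
        · rintro ⟨u, hu, huz⟩
          exact ⟨u, (hYmem σ u).1 hu, huz⟩
    rw [hρ]
    linarith
  -- sum up
  have hwt : ∀ σ : Finset (Fin m), 0 ≤ (∏ i ∈ σ, θ i) * ∏ i ∈ Finset.univ \ σ, (1 - θ i) :=
    fun σ => patternWeight_nonneg θ hθ0 hθ1 σ
  have hlow : 0 ≤ ∑ σ ∈ (Finset.univ : Finset (Fin m)).powerset, ((∏ i ∈ σ, θ i) * ∏ i ∈ Finset.univ \ σ, (1 - θ i)) *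
      ((prodBernoulli w).real {ω : BondConfig (Fin n) |
          (∀ u ∈ R, ¬ (openGraph (ξ ω ∪ ↑(σ.image fun i => (s(p i, p' i) : Sym2 (Fin n))))).Reachable c u) ∧
          (A.filter fun z => (openGraph (ξ ω ∪ ↑(σ.image fun i => (s(p i, p' i) : Sym2 (Fin n))))).Reachable c z).card ≤ j} -
        (prodBernoulli w).real {ω : BondConfig (Fin n) |
          (∀ u ∈ R, ¬ (openGraph (ξ ω ∪ ↑(σ.image fun i => (s(p i, p' i) : Sym2 (Fin n))))).Reachable c u) ∧
          1 ≤ (A.filter fun z => ∃ u ∈ R,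
            (openGraph (ξ ω ∪ ↑(σ.image fun i => (s(p i, p' i) : Sym2 (Fin n))))).Reachable u z).card ∧
          (A.filter fun z => ∃ u ∈ R,
            (openGraph (ξ ω ∪ ↑(σ.image fun i => (s(p i, p' i) : Sym2 (Fin n))))).Reachable u z).card ≤ j}) := by
    have h := sub_nonneg.2 hrow
    rw [← Finset.sum_sub_distrib] at h
    refine le_trans h (le_of_eq (Finset.sum_congr rfl fun σ _ => ?_))
    ring
  refine le_trans hlow (Finset.sum_le_sum fun σ _ => mul_le_mul_of_nonneg_left (hterm σ) (hwt σ))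

/-- **The comonotone word is nonnegative** (cell port sets `Y(σ) = P_σ`; restatement of `StarSet.comonotone_word_nonneg` for any
description of the port sets by membership). [folklore] -/
theorem comonotoneWord_nonneg (w : Sym2 (Fin n) → unitInterval) (A : Finset (Fin n)) (s p p' : Fin m → Fin n) (c : Fin n)
    (j : ℕ) (hj : j ≤ 2) (hs : Function.Injective s) (hsA : ∀ i, s i ∉ A) (hpA : ∀ i, p i ∈ A) (hp'A : ∀ i, p' i ∈ A)
    (hpp' : ∀ i, p i ≠ p' i) (hdis : ∀ i k, i ≠ k → p i ≠ p k ∧ p i ≠ p' k ∧ p' i ≠ p' k) (hcA : c ∈ A)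
    (hcp : ∀ i, c ≠ p i ∧ c ≠ p' i) (hwjunk : ∀ i u, u ≠ s i → u ≠ p i → u ≠ p' i → w s(s i, u) = 0)
    (hdom : ∀ i, (prodBernoulli w).real {ω : BondConfig (Fin n) | (A.filter fun z => ω ∈ openConn (p i) z).card ≤ j} ≤
      (prodBernoulli w).real {ω : BondConfig (Fin n) | (A.filter fun z => ω ∈ openConn c z).card ≤ j})
    (Y : Finset (Fin m) → Finset (Fin n)) (hY : ∀ σ, Y σ = σ.image p ∪ σ.image p') :
    0 ≤ ∑ σ ∈ (Finset.univ : Finset (Fin m)).powerset,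
      ((∏ i ∈ σ, ((w s(s i, p i) : ℝ) * w s(s i, p' i))) *
          ∏ i ∈ Finset.univ \ σ, (1 - (w s(s i, p i) : ℝ) * w s(s i, p' i))) *
        ((prodBernoulli w).real {ω : BondConfig (Fin n) |
            (∀ u ∈ Y σ, ¬ (openGraph (ω ∩ {e | ∀ v ∈ Finset.univ.image s, v ∉ e})).Reachable c u) ∧
            (A.filter fun z => (openGraph (ω ∩ {e | ∀ v ∈ Finset.univ.image s, v ∉ e})).Reachable c z).card ≤ j} -
          (prodBernoulli w).real {ω : BondConfig (Fin n) |
            (∀ u ∈ Y σ, ¬ (openGraph (ω ∩ {e | ∀ v ∈ Finset.univ.image s, v ∉ e})).Reachable c u) ∧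
            1 ≤ (A.filter fun z => ∃ u ∈ Y σ, (openGraph (ω ∩ {e | ∀ v ∈ Finset.univ.image s, v ∉ e})).Reachable u z).card ∧
            (A.filter fun z => ∃ u ∈ Y σ,
              (openGraph (ω ∩ {e | ∀ v ∈ Finset.univ.image s, v ∉ e})).Reachable u z).card ≤ j}) := by
  have h := comonotone_word_nonneg w A s p p' c j hj hs hsA hpA hp'A hpp' hdis hcA hcp hwjunk hdom
  refine le_trans h (le_of_eq (Finset.sum_congr rfl fun σ _ => ?_))
  rw [hY σ]

/-- **OES at level `j ≤ 2` for a set of two-port pendant stars with pairwise distinct ports (any number of stars).**  See the file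
header: `μ(c ↮ S, 1 ≤ |π(S)| ≤ j) ≤ μ(c ↮ S, |π(c)| ≤ j)` for `S = {s i : i < m}`.
[cite: VandenbergHaggstromKahn2005, Thm. 1.5 (p. 7) — the only non-elementary input, via `observerSet_le_of_lonelier`] -/
theorem setCS_twoPortStars_levelTwo (w : Sym2 (Fin n) → unitInterval) (A : Finset (Fin n)) (s p p' : Fin m → Fin n)
    (c : Fin n) (j : ℕ) (hj : j ≤ 2) (hs : Function.Injective s) (hsA : ∀ i, s i ∉ A) (hpA : ∀ i, p i ∈ A)
    (hp'A : ∀ i, p' i ∈ A) (hpp' : ∀ i, p i ≠ p' i) (hdis : ∀ i k, i ≠ k → p i ≠ p k ∧ p i ≠ p' k ∧ p' i ≠ p' k)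
    (hcA : c ∈ A) (hcp : ∀ i, c ≠ p i ∧ c ≠ p' i)
    (hobs : ∀ i u, u ≠ s i → u ≠ p i → u ≠ p' i → w s(s i, u) = 0)
    (hdom : ∀ i,
      (prodBernoulli w).real {ω : BondConfig (Fin n) | (A.filter fun z => ω ∈ openConn (p i) z).card ≤ j} ≤
          (prodBernoulli w).real {ω : BondConfig (Fin n) | (A.filter fun z => ω ∈ openConn c z).card ≤ j} ∧
        (prodBernoulli w).real {ω : BondConfig (Fin n) | (A.filter fun z => ω ∈ openConn (p' i) z).card ≤ j} ≤
          (prodBernoulli w).real {ω : BondConfig (Fin n) | (A.filter fun z => ω ∈ openConn c z).card ≤ j}) :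
    (prodBernoulli w).real {ω : BondConfig (Fin n) | (∀ x ∈ Finset.univ.image s, ω ∉ openConn c x) ∧
        1 ≤ (A.filter fun z => ∃ x ∈ Finset.univ.image s, ω ∈ openConn x z).card ∧
        (A.filter fun z => ∃ x ∈ Finset.univ.image s, ω ∈ openConn x z).card ≤ j} ≤
      (prodBernoulli w).real {ω : BondConfig (Fin n) | (∀ x ∈ Finset.univ.image s, ω ∉ openConn c x) ∧
        (A.filter fun z => ω ∈ openConn c z).card ≤ j} := by
  have hps : ∀ i k, p i ≠ s k := fun i k h => hsA k (h ▸ hpA i)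
  have hp's : ∀ i k, p' i ≠ s k := fun i k h => hsA k (h ▸ hp'A i)
  have hcs : ∀ i, c ≠ s i := fun i h => hsA i (h ▸ hcA)
  rw [← sub_nonneg, setCSdiff_gate_expansion w A s p p' c j hs hsA hps hp's hpp' hdis hcs hobs]
  have hre := extreme_regroup (fun i => (w s(s i, p i) : ℝ)) (fun i => (w s(s i, p' i) : ℝ)) (fun i => (w _).2.1)
    (fun i => (w _).2.2) (fun i => (w _).2.1) (fun i => (w _).2.2)
    (fun t => (prodBernoulli w).real {ω : BondConfig (Fin n) |
        (∀ u ∈ (Finset.univ.filter fun i => (t i).1 = true).image p ∪ (Finset.univ.filter fun i => (t i).2 = true).image p',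
          ¬ (openGraph (ω ∩ {e | ∀ v ∈ Finset.univ.image s, v ∉ e})).Reachable c u) ∧
        (A.filter fun z => (openGraph (ω ∩ {e | ∀ v ∈ Finset.univ.image s, v ∉ e})).Reachable c z).card ≤ j} -
      (prodBernoulli w).real {ω : BondConfig (Fin n) |
        (∀ u ∈ (Finset.univ.filter fun i => (t i).1 = true).image p ∪ (Finset.univ.filter fun i => (t i).2 = true).image p',
          ¬ (openGraph (ω ∩ {e | ∀ v ∈ Finset.univ.image s, v ∉ e})).Reachable c u) ∧
        1 ≤ (A.filter fun z => ∃ u ∈ (Finset.univ.filter fun i => (t i).1 = true).image p ∪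
            (Finset.univ.filter fun i => (t i).2 = true).image p',
          (openGraph (ω ∩ {e | ∀ v ∈ Finset.univ.image s, v ∉ e})).Reachable u z).card ∧
        (A.filter fun z => ∃ u ∈ (Finset.univ.filter fun i => (t i).1 = true).image p ∪
            (Finset.univ.filter fun i => (t i).2 = true).image p',
          (openGraph (ω ∩ {e | ∀ v ∈ Finset.univ.image s, v ∉ e})).Reachable u z).card ≤ j})
  beta_reduce at hre
  rw [hre]
  refine Finset.sum_nonneg fun e _ => mul_nonneg (Finset.prod_nonneg fun i _ =>
    extremeCoeff_nonneg _ _ (w _).2.1 (w _).2.2 (w _).2.1 (w _).2.2 (e i)) ?_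
  by_cases he : ∀ i, e i = 0
  · refine comonotoneWord_nonneg w A s p p' c j hj hs hsA hpA hp'A hpp' hdis hcA hcp hobs (fun i => (hdom i).1) _ ?_
    intro σ
    ext u
    simp only [he, Finset.mem_union, Finset.mem_image, Finset.mem_filter, Finset.mem_univ, true_and]
    constructor
    · rintro (⟨i, hi, rfl⟩ | ⟨i, hi, rfl⟩)
      · by_cases hiσ : i ∈ σ
        · exact Or.inl ⟨i, hiσ, rfl⟩
        · simp [hiσ] at hi
      · by_cases hiσ : i ∈ σ
        · exact Or.inr ⟨i, hiσ, rfl⟩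
        · simp [hiσ] at hi
    · rintro (⟨i, hi, rfl⟩ | ⟨i, hi, rfl⟩)
      · exact Or.inl ⟨i, by simp [hi], rfl⟩
      · exact Or.inr ⟨i, by simp [hi], rfl⟩
  · push Not at he
    obtain ⟨i₀, hi₀⟩ := he
    refine gluedWord_nonneg w A s p p' c j hj hs hsA hpA hp'A hpp' hcA hcp hobs hdom e i₀ hi₀ _ ?_
    intro σ u
    simp only [Finset.mem_union, Finset.mem_image, Finset.mem_filter, Finset.mem_univ, true_and]
    constructor
    · rintro (⟨i, hi, rfl⟩ | ⟨i, hi, rfl⟩)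
      · by_cases hiσ : i ∈ σ
        · exact Or.inr (Or.inl ⟨i, hiσ, rfl⟩)
        · simp only [hiσ, if_false, decide_eq_true_eq] at hi
          exact Or.inl (Or.inl ⟨i, hi, rfl⟩)
      · by_cases hiσ : i ∈ σ
        · exact Or.inr (Or.inr ⟨i, hiσ, rfl⟩)
        · simp only [hiσ, if_false, decide_eq_true_eq] at hi
          exact Or.inl (Or.inr ⟨i, hi, rfl⟩)
    · rintro ((⟨i, hi, rfl⟩ | ⟨i, hi, rfl⟩) | (⟨i, hi, rfl⟩ | ⟨i, hi, rfl⟩))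
      · refine Or.inl ⟨i, ?_, rfl⟩
        by_cases hiσ : i ∈ σ
        · simp [hiσ]
        · simp [hiσ, hi]
      · refine Or.inr ⟨i, ?_, rfl⟩
        by_cases hiσ : i ∈ σ
        · simp [hiσ]
        · simp [hiσ, hi]
      · exact Or.inl ⟨i, by simp [hi], rfl⟩
      · exact Or.inr ⟨i, by simp [hi], rfl⟩

end StarSet

end Summit.CriticalPhenomena.PercolationContinuityZ3.Theorems

end
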